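import Mathlib.SetTheory.Cardinal.Continuum
import Mathlib.FieldTheory.IsAlgClosed.Basic
import Mathlib.LinearAlgebra.FiniteDimensional.Defs
import Literature.NumberTheory.Transcendental.ZilberField
import HarnessLib

/-!
# Finitely generated partial exponential fields with standard kernel — the bases of
Bays–Kirby's variants of pseudo-exponentiation (Bays–Kirby 2018, Def. 3.8, Def. 3.15, §9.1–9.2)

M. Bays, J. Kirby, *Pseudo-exponential maps, variants, and quasiminimality*, Algebra & Number
Theory 12 (2018) 493–549 (arXiv:1512.04262v4), construct for every *essentially finitary Γ-field*
`F_base` of type (EXP) a canonical *Γ-closed field* `𝕄(F_base)` — "the unique model of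
cardinality continuum" of the axioms `ΓCF_CCP(F_base)` — in four stages (§1.2, p. 4): the
category of strong extensions of `F_base` (§§3–4); Fraïssé amalgamation giving a countable model
`M(F_base)` (Thm 5.9, Notation 5.10); `M(F_base)` is a quasiminimal pregeometry structure
(Thm 6.9), whence (Fact 6.4 = Bays–Hart–Hyttinen–Kesälä–Kirby 2014, Thm 2.3) a quasiminimal
class with exactly one model of each uncountable cardinality, all quasiminimal (Thm 1.7); and
the axiomatisation of that class (Thm 8.2, axioms 1–5: full Γ-field; base and kernels;
predimension inequality over the base; strong Γ-closedness over `Γ(F_base) ∪ a`; countable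
closure property). §9.1 specialises this to pseudo-exponentiation (`k = ℚ`, `G₁ = 𝔾ₐ`,
`G₂ = 𝔾ₘ`, `𝒪 = ℤ`; Thm 9.1, Zilber's `𝔹`), and §9.2 to bases *incorporating a
counterexample to Schanuel's conjecture*: "More generally, we can take any finitely generated
partial exponential field with standard kernel (that is, a finitely generated Γ-field for the
appropriate groups and kernels) as `F_base` and do the same construction to build a quasiminimal
exponential field `𝕄(F_base)` of size continuum with counterexamples to the Schanuel property
within a finite-dimensional `ℚ`-vector space, but with the Schanuel property holding over that
vector space. Each `𝕄(F_base)` is unique up to isomorphism as a model of appropriate axioms,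
just as `𝔹` is." (§9.2, p. 28).

This file vendors the BASES of that construction in the exponential case — the hypothesis
structure `Literature.NumberTheory.Transcendental.IsStdKernelPartialExpField` rendering "finitely
generated partial exponential field with standard kernel" — with its elementary API, and the
(proved) remark that axiom 4 of Thm 8.2 (strong exponential-algebraic closedness over
`Γ(F_base) ∪ a`) contains Kirby's linear-independence scheme
`Literature.NumberTheory.Transcendental.IsLinIndepExpAlgClosed`
(`isLinIndepExpAlgClosed_of_closed_over_base`). Its user is the barrier
`Literature.Barriers.Schanuel.baysKirby2018_modelsWithoutSchanuel` (the fields `𝔹_P`, §9.2),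
whose sibling proof file `Literature/Barriers/Schanuel/AxiomsDoNotForceSchanuelProofs.lean`
constructs the §9.2 base inside `ℂ` as an `IsStdKernelPartialExpField` and assembles `𝔹_P` from a
model over it.

## What is NOT vendored here: the construction theorem (Thm 1.7 with Thm 8.2)

The existence of `𝕄(F_base)` over such a base — an exponential field `F ⊇ K` with `#F = 𝔠`,
quasiminimal, ELA, extending `θ` with kernel `τℤ`, `K` strong in `F`, strongly
exponentially-algebraically closed over `Γ(K) ∪ a`, with the countable closure property — is
Thm 1.7 + Thm 8.2 of the paper, whose proof is its body (§§3–8: Kummer theory for good bases,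
Prop. 3.22; full closures, §4; amalgamation, Thm 5.9; the quasiminimal pregeometry structure,
Thm 6.9; the axiomatisation, Thm 8.2) together with Bays–Hart–Hyttinen–Kesälä–Kirby 2014,
Thm 2.3 and Kirby 2010 (`ecl` versus `Γcl`, Remark 10.10). The tree has the Γ-field algebra
(`GammaFields.lean`), Kirby's `ecl` (`EclPregeometry*.lean`, `GammaFieldsEcl.lean`) and the
countable-model part of the quasiminimal-class theory
(`Literature/ModelTheory/Quasiminimal/`), but neither the amalgamation construction of
`M(F_base)` nor the uncountable models of a quasiminimal class. Until 2026-08-15 this file stated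
that theorem as a stand-alone named fact `baysKirby2018_modelOverPartialExpField`; under the
fact-decomposition discipline (D-0026: a decomposition child must be a distinct, M-sized published
result — this one is the paper's main theorem, larger than its only consumer) it was merged back
into the proof obligation of the barrier fact, whose proof file now carries the construction as
an explicit hypothesis (`baysKirby2018_modelsWithoutSchanuel_of_softModels`). Nothing in this
file is unproved.

## The base (Bays–Kirby Def. 3.8, Def. 3.15, §9.1–9.2; Kirby 2013 "FPEF" §2)

In the exponential case a Γ-field is a field `K ⊇ ℚ` together with a divisible subgroup
`Γ(K) ≤ 𝔾ₐ(K) × 𝔾ₘ(K)` whose coordinates generate `K` and whose projections contain the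
torsion (Def. 3.8); it is finitely generated when `Γ(K)` has finite rank (Def. 3.15), and then
*essentially finitary* (Def. 3.21), which is the hypothesis of Thm 1.7; its kernels are
`ker₁ = {x : (x, 1) ∈ Γ}` and `ker₂ = {y : (0, y) ∈ Γ}`. A *partial exponential field*
(Kirby 2013 FPEF, Def. 2.2) is the case `Γ(K)` = graph of a homomorphism `θ : D(K) → Kˣ` on a
`ℚ`-subspace `D(K)` (so `ker₂ = 1`); "standard kernel" (Thm 9.1 axiom 2) means `ker θ = τℤ`
with `τ` transcendental. `IsStdKernelPartialExpField K D θ τ` records exactly: `D ≤ K` a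
finite-dimensional `ℚ`-subspace, `θ` a homomorphism `(D, +) → (Kˣ, ·)` (only the values of
`θ : K → K` on `D` are constrained), `τ ∈ D` transcendental with `{x ∈ D : θ x = 1} = τℤ`, and
`K = ℚ(D ∪ θ(D))` ("`A` is generated as a field by `Γ(A)`"). The torsion clause of Def. 3.8 is
then automatic: `Tor₁ = 0`, and `θ(τ/m)` has order exactly `m`, so `θ(ℚτ)` is the group of all
roots of unity (`IsStdKernelPartialExpField.map_nsmul` below records the input
`θ (m • x) = θ x ^ m` of that order computation). The §9.2 base is `K = ℚ^{ab}(τ, (ε_m)_m)`,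
`D = span_ℚ(τ, 1)`, `θ(τ/m) = ω_m`, `θ(1/m) = ε_m`; the base `SK` of §9.1 has `D = ℚτ`.

## References

* M. Bays, J. Kirby, *Pseudo-exponential maps, variants, and quasiminimality*, Algebra & Number
  Theory 12 (2018) 493–549, arXiv:1512.04262v4: §1.2 (p. 4), Thm 1.7, Def. 3.8, Def. 3.15,
  Def. 3.21, Thm 5.9, Fact 6.4, Thm 6.9, Thm 8.2 (p. 26), Thm 9.1, §9.2 (p. 28), Remark 10.10.
* J. Kirby, *Finitely presented exponential fields*, Algebra & Number Theory 7 (2013) 943–980,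
  §2 (partial exponential fields, the base `SK`).
* M. Bays, B. Hart, T. Hyttinen, M. Kesälä, J. Kirby, *Quasiminimal structures and excellence*,
  Bull. LMS 46 (2014) 155–163, Thm 2.3.
* J. Kirby, *Exponential algebraicity in exponential fields*, Bull. LMS 42 (2010) 879–890
  (`ecl`).
-/

noncomputable section

open Cardinal
open FirstOrder

namespace Literature.NumberTheory.Transcendental

open Literature.ModelTheory.ExponentialFields
open Literature.ModelTheory.ExponentialFields.ExponentialRing

/-! ### Finitely generated partial exponential fields with standard kernel -/

/-- **A finitely generated partial exponential field with standard kernel** (Bays–Kirby 2018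
§9.2: "any finitely generated partial exponential field with standard kernel (that is, a
finitely generated Γ-field for the appropriate groups and kernels)"; Γ-fields: Def. 3.8, finitely
generated: Def. 3.15, standard kernel: Thm 9.1 axiom 2; partial exponential fields: Kirby 2013
FPEF §2). The data: a field `K` of characteristic zero, a `ℚ`-subspace `D ≤ K` (the domain of the
partial exponential map, `Γ(K) = {(x, θ x) : x ∈ D}`), a map `θ : K → K` of which only the values
on `D` matter, and the kernel generator `τ`. The conditions: `D` is finite-dimensional
(`Γ(K)` of finite rank); `θ` restricted to `D` is a homomorphism into `Kˣ`; `τ ∈ D` is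
transcendental and `{x ∈ D : θ x = 1} = τℤ` (standard kernel); and `K` is generated as a field by
the coordinates `D ∪ θ(D)` of `Γ(K)`. (The torsion clause of Def. 3.8 — `θ(D)` contains all roots
of unity — follows: `θ(τ/m)` has order `m`.) The base of §9.2 has `D = span_ℚ(τ, 1)`,
`θ(τ/m) = ω_m`, `θ(1/m) = ε_m`; the base `SK` of §9.1 has `D = ℚτ`.
[cite: BaysKirby2018ANT, §9.2 with Def. 3.8, Def. 3.15, Thm 9.1 (2)] -/
structure IsStdKernelPartialExpField (K : Type*) [Field K] [CharZero K]
    (D : Submodule ℚ K) (θ : K → K) (τ : K) : Prop where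
  /-- `Γ(K)` has finite rank: the domain `D` is a finite-dimensional `ℚ`-subspace. -/
  finiteDimensional : FiniteDimensional ℚ D
  /-- `θ` is a homomorphism `(D, +) → (K, ·)` … -/
  map_add : ∀ ⦃x y : K⦄, x ∈ D → y ∈ D → θ (x + y) = θ x * θ y
  /-- … with values in `Kˣ = 𝔾ₘ(K)`. -/
  map_ne_zero : ∀ ⦃x : K⦄, x ∈ D → θ x ≠ 0
  /-- The kernel generator lies in the domain … -/
  mem : τ ∈ D
  /-- … is transcendental … -/
  transcendental : Transcendental ℚ τ
  /-- … and generates the kernel: `θ x = 1 ↔ x ∈ τℤ` for `x ∈ D` (standard kernel). -/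
  map_eq_one_iff : ∀ ⦃x : K⦄, x ∈ D → (θ x = 1 ↔ x ∈ AddSubgroup.zmultiples τ)
  /-- `K` is generated as a field by the coordinates of `Γ(K)`, i.e. by `D ∪ θ(D)`. -/
  closure_eq_top : Subfield.closure ((D : Set K) ∪ θ '' D) = ⊤

namespace IsStdKernelPartialExpField

variable {K : Type*} [Field K] [CharZero K] {D : Submodule ℚ K} {θ : K → K} {τ : K}

/-- `θ 0 = 1`. [folklore] -/
theorem map_zero (h : IsStdKernelPartialExpField K D θ τ) : θ 0 = 1 := by
  have h0 : θ (0 + 0) = θ 0 * θ 0 := h.map_add D.zero_mem D.zero_mem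
  rw [add_zero] at h0
  exact (mul_eq_left₀ (h.map_ne_zero D.zero_mem)).mp h0.symm

/-- The kernel generator is in the kernel: `θ τ = 1`. [folklore] -/
theorem map_tau (h : IsStdKernelPartialExpField K D θ τ) : θ τ = 1 :=
  (h.map_eq_one_iff h.mem).mpr (AddSubgroup.mem_zmultiples τ)

/-- `θ (m • x) = θ x ^ m` on `D` (so `θ (τ/m)` is an `m`-th root of unity, primitive since the
kernel is exactly `τℤ`). [folklore] -/
theorem map_nsmul (h : IsStdKernelPartialExpField K D θ τ) {x : K} (hx : x ∈ D) (m : ℕ) :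
    θ (m • x) = θ x ^ m := by
  induction m with
  | zero => rw [zero_smul, pow_zero, h.map_zero]
  | succ m ih => rw [succ_nsmul, h.map_add (D.smul_of_tower_mem m hx) hx, ih, pow_succ]

/-- The kernel generator is non-zero. [folklore] -/
theorem tau_ne_zero (h : IsStdKernelPartialExpField K D θ τ) : τ ≠ 0 := fun h0 =>
  h.transcendental (h0 ▸ isAlgebraic_zero)

end IsStdKernelPartialExpField

/-! ### Axiom 4 over the base contains Kirby's scheme (Bays–Kirby Thm 8.2 (4) ⇒ Thm 9.1 (4)) -/

/-- **Strong exponential-algebraic closedness over the base implies Kirby's scheme.** Axiom 4 of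
Bays–Kirby Thm 8.2 for a model `F` over a base with domain `D` embedded by `ι` — for every
irreducible rotund, additively and multiplicatively free subvariety `V = W ∩ Gⁿ` of
`Gⁿ = Fⁿ × (Fˣ)ⁿ` of dimension `n` and every finite `A ⊆ F` there is `(x̄, e^x̄) ∈ V` such that no
non-zero `ℤ`-linear combination of `x̄` lies in the `ℚ`-span of `ι(D) ∪ A` ("`b` is
`k_𝒪`-linearly independent over `Γ(F_base) ∪ a`", in the first coordinates, `Γ(F)` being the
graph of `exp`) — implies the linear-independence scheme `IsLinIndepExpAlgClosed F` of Thm 9.1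
(4) (independence over `A` alone), since `span_ℚ A ≤ span_ℚ (ι D ∪ A)`.
[cite: BaysKirby2018ANT, Thm 8.2 (4) and Thm 9.1 (4)] -/
theorem isLinIndepExpAlgClosed_of_closed_over_base {K F : Type*} [Field K] [CharZero K] [Field F]
    [CharZero F]
    [ExponentialRing F] (ι : K →+* F) (D : Submodule ℚ K)
    (h4 : ∀ (n : ℕ) (W : Set (Fin n ⊕ Fin n → F)), IsIrreducibleClosed F W →
        (W ∩ torusLocus F n).Nonempty → IsRotund F n (W ∩ torusLocus F n) →
        IsAddFree F n (W ∩ torusLocus F n) → IsMulFree F n (W ∩ torusLocus F n) →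
        zariskiDim F W = n →
        ∀ A : Finset F, ∃ z ∈ W ∩ expGraph F n,
          ∀ m : Fin n → ℤ, (∑ i, (m i : F) * z (Sum.inl i)) ∈
            Submodule.span ℚ (ι '' D ∪ ↑A) → m = 0) :
    IsLinIndepExpAlgClosed F := by
  intro n W hirr hne hrot hadd hmul hdim A
  obtain ⟨z, hz, hlin⟩ := h4 n W hirr hne hrot hadd hmul hdim A
  exact ⟨z, hz, fun m hm => hlin m (Submodule.span_mono Set.subset_union_right hm)⟩

end Literature.NumberTheory.Transcendental

end
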